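import Literature.AnabelianGeometry.EtaleTheta.ThetaSystemsInvToyTower
import HarnessLib

/-!
# The inversion-twisted toy tower: shears divisible by the level are automorphisms of the model
# mono-theta environments; the twisted projective system (part 2 of 3 of: the tower form of
# [EtTh] Cor. 2.19 (ii) is a SCHEMA)

Continuation of `ThetaSystemsInvToyTower.lean` (cell `abc-iut`; see the module docstring there for the
mathematics and the honest framing).  S. Mochizuki, *The Étale Theta Function …* [EtTh], Publ. RIMS 45
(2009), §2: Def. 2.13 (i)–(ii) pp.47–48 (the model mono-theta environment
`M_M = (Π^tp_Y[μ_M], D_Y, [Im s^Θ_Ÿ])` and its isomorphisms), Cor. 2.19 (ii) p.64 (projective systems of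
mono-theta environments, typed as `ThetaEnvTower.MTESystem` in `ThetaSystems.lean`).

* `InvToy.shearIso M r hr` — for `M ∣ r`, the shear `envShearC M r` of `Π^tp_Y[μ_M]` IS an automorphism
  of the model `M_M` of the toy (`MonoThetaEnv.Iso`): it fixes the cyclotome, commutes with every Kummer
  shift and every `Gal(Y/X)`-conjugation (so it fixes `D_Y ⊆ Out` elementwise,
  `map_transport_envShearC_DY`), and stabilises `Im(s^Θ)` (`η_M ∘ shear_r = η_M` on `Π^tp_Ÿ` when
  `M ∣ r`; the `μ_M`-conjugacy class of `Im(s^Θ)` is a singleton, `map_conj_inMu_range_sTheta`).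
* `InvToy.system x hx` — the TWISTED projective system of mono-theta environments attached to a compatible
  family of residues `x = (x_M ∈ ℤ/M)_M`: twists `a_{M',M} :=` the shear by `k_M - k_{M'}` (`k_M` the
  integer lifts `InvToy.lift x M` of `x_M`; `M ∣ k_M - k_{M'}` by compatibility), `a_{M,M} = 1`, and the
  cocycle identity `a_{M'',M} ∘ red = a_{M',M} ∘ red ∘ a_{M'',M'} ∘ red` (shears add up).

Part 3 (`ThetaSystemsInvToyCor219ii.lean`) shows that for `x` NON-INTEGRAL (Rmk. 2.16.1 (iii)) this system
is not isomorphic to the natural one.  Seat abc-iut-w5-d071 (F-TRANCHES 154, row F-0649).  No bearing on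
[IUTchIII] Cor. 3.12; no side taken; typed ≠ proved.  No instances, no notation.
-/

namespace Literature.AnabelianGeometry.EtaleTheta

namespace ThetaEnvTower

namespace InvToy

open Toy CycEnvelope

variable {E : Set ℕ+}

/-! ## §6. Shears divisible by the level are automorphisms of the model mono-theta environment -/

/-- An element of `Π^tp_X = ℤ³` killed by a nonzero power is trivial (`ℤ³` is torsion-free).
[cite: MochizukiEtTh2009, Def 2.13 p.47] -/
theorem eq_one_of_pow_eq_one {g : P} {n : ℕ} (hn : n ≠ 0) (h : g ^ n = 1) : g = 1 := by
  have key : ∀ t : Zm, t ^ n = 1 → t = 1 := fun t ht => by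
    rw [← ofAdd_toAdd t, ← ofAdd_nsmul, nsmul_eq_mul] at ht
    have ht' : (n : ℤ) * Multiplicative.toAdd t = 0 := Multiplicative.ofAdd.injective ht
    rcases Int.mul_eq_zero.1 ht' with h0 | h0
    · exact absurd (Int.natCast_eq_zero.1 h0) hn
    · rw [← ofAdd_toAdd t, h0]; rfl
  obtain ⟨x, y, z⟩ := g
  simp only [Prod.pow_mk, Prod.mk_eq_one] at h
  obtain ⟨hx, hy, hz⟩ := h
  rw [key x hx, key y hy, key z hz]; rfl

/-- `castM M (t ^ r) = 1` when `M ∣ r`. [cite: MochizukiEtTh2009, Def 2.13 p.47] -/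
theorem castM_zpow_eq_one (M : ℕ+) {r : ℤ} (hr : (r : ZMod M) = 0) (t : Zm) : castM M t ^ r = 1 := by
  rw [castM_apply, ← ofAdd_zsmul, zsmul_eq_mul, hr, zero_mul]; rfl

/-- A shear divisible by `M` does not change `η_M`. [cite: MochizukiEtTh2009, Cor 2.19(ii) p.64] -/
theorem eta_shearYdd (M : ℕ+) {r : ℤ} (hr : (r : ZMod M) = 0) (g : PiYdd0) :
    eta M (shearYdd r g) = eta M g := by
  rw [eta_apply, eta_apply, coe_shearYdd, pz_shear, map_mul, map_zpow, castM_zpow_eq_one M hr, mul_one]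

variable (h1 : (1 : ℕ+) ∈ E) (hcof : ∀ n : ℕ+, ∃ M ∈ E, n ∣ M)
  (htot : ∀ M ∈ E, ∀ M' ∈ E, M ∣ M' ∨ M' ∣ M)

/-- `η_M` is a (the) theta cocycle of the toy at level `M`. [cite: MochizukiEtTh2009, Cor 2.19(ii) p.64] -/
theorem eta_mem (M : E) : eta M ∈ (toy h1 hcof htot).thetaCocycles M := Set.mem_singleton _

/-- The theta section of the toy in coordinates: `s^Θ(g) = (η_M(g)⁻¹, g)`.
[cite: MochizukiEtTh2009, Def 2.13(i) p.47] -/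
theorem sTheta_apply (M : E) (g : PiYdd0) :
    ((toy h1 hcof htot).level M).sTheta (eta_mem h1 hcof htot M) g =
      (⟨(eta M g)⁻¹, ⟨g, g.2.2⟩⟩ : Env M) := rfl

/-- `s^Θ(0, 2, 0) = s^alg(0, 1, 0)²` (`η_M(0, 2, 0) = 1`). [cite: MochizukiEtTh2009, Def 2.13(i) p.47] -/
theorem sTheta_two (M : E) :
    ((toy h1 hcof htot).level M).sTheta (eta_mem h1 hcof htot M)
        ⟨(1, (Multiplicative.ofAdd (2 : ℤ), 1)), two_mem_PiYdd0⟩ =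
      (SemidirectProduct.inr ⟨(1, (Multiplicative.ofAdd (1 : ℤ), 1)), rfl⟩ : Env M) *
        SemidirectProduct.inr ⟨(1, (Multiplicative.ofAdd (1 : ℤ), 1)), rfl⟩ := by
  rw [← map_mul, sTheta_apply]
  refine SemidirectProduct.ext ?_ (Subtype.ext rfl)
  rw [SemidirectProduct.left_inr, eta_apply, castM_apply, inv_eq_one]
  change Multiplicative.ofAdd (((Multiplicative.toAdd (1 : Zm) : ℤ)) : ZMod M) = 1
  rw [toAdd_one, Int.cast_zero]
  rfl

/-- Conjugation by the cyclotome fixes the theta section pointwise (`Π^tp_Ÿ` acts trivially on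
`μ_M`), so the `μ_M`-conjugacy class of `Im(s^Θ)` is a singleton. [cite: MochizukiEtTh2009, Def 2.13(ii) p.47] -/
theorem map_conj_inMu_range_sTheta (M : E) (c : Mu M) :
    (((toy h1 hcof htot).level M).sTheta (eta_mem h1 hcof htot M)).range.map
        (MulAut.conj (inMu augY0 (chi M) c)).toMonoidHom =
      (((toy h1 hcof htot).level M).sTheta (eta_mem h1 hcof htot M)).range := by
  refine SetLike.coe_injective ?_
  rw [Subgroup.coe_map]
  refine Set.EqOn.image_eq_self ?_
  rintro _ ⟨g, rfl⟩
  rw [id, MulEquiv.coe_toMonoidHom, conj_inMu_eq_shift_coboundary, shift_apply, sTheta_apply]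
  refine SemidirectProduct.ext ?_ rfl
  change (eta M g)⁻¹ * coboundary augY0 (chi M) c ⟨g, g.2.2⟩ = (eta M g)⁻¹
  rw [CycEnvelope.coboundary, MonoidHom.comp_apply, Subgroup.subtype_apply, chi_py_eq_one g.2,
    MulAut.one_apply, mul_inv_cancel, mul_one]

/-- A shear divisible by `M` commutes with the theta section up to the shear of `Π^tp_Ÿ`.
[cite: MochizukiEtTh2009, Cor 2.19(ii) p.64] -/
theorem envShear_sTheta (M : E) {r : ℤ} (hr : (r : ZMod (M : ℕ+)) = 0) (g : PiYdd0) :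
    envShear M r (((toy h1 hcof htot).level M).sTheta (eta_mem h1 hcof htot M) g) =
      ((toy h1 hcof htot).level M).sTheta (eta_mem h1 hcof htot M) (shearYdd r g) := by
  rw [sTheta_apply, sTheta_apply, envShear_apply, eta_shearYdd M hr]
  exact SemidirectProduct.ext rfl (Subtype.ext rfl)

/-- A shear divisible by `M` stabilises `Im(s^Θ)`. [cite: MochizukiEtTh2009, Cor 2.19(ii) p.64] -/
theorem map_envShear_range_sTheta (M : E) {r : ℤ} (hr : (r : ZMod (M : ℕ+)) = 0) :
    (((toy h1 hcof htot).level M).sTheta (eta_mem h1 hcof htot M)).range.map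
        (envShear M r).toMonoidHom =
      (((toy h1 hcof htot).level M).sTheta (eta_mem h1 hcof htot M)).range := by
  have hcomp : (envShear M r).toMonoidHom.comp
      (((toy h1 hcof htot).level M).sTheta (eta_mem h1 hcof htot M)) =
      (((toy h1 hcof htot).level M).sTheta (eta_mem h1 hcof htot M)).comp
        (shearYdd r).toMonoidHom :=
    MonoidHom.ext fun g => envShear_sTheta h1 hcof htot M hr g
  rw [MonoidHom.map_range, hcomp, MonoidHom.range_comp, MonoidHom.range_eq_top.2
    (shearYdd r).surjective, ← MonoidHom.range_eq_map]

/-- A shear divisible by `M` commutes with every Kummer shift and every `Gal(Y/X)`-conjugation, hence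
stabilises `D_Y` (elementwise, in `Out`). [cite: MochizukiEtTh2009, Def 2.13(i) p.47] -/
theorem map_transport_envShearC_DY (M : E) (r : ℤ) :
    ((toy h1 hcof htot).level M).DY.map (TopOut.transport (envShearC M r)) =
      ((toy h1 hcof htot).level M).DY := by
  rw [ThetaEnvData.DY, MonoidHom.map_closure]
  congr 1
  refine Set.EqOn.image_eq_self ?_
  rintro s (⟨δ, hδ, hc, rfl⟩ | ⟨g, hc, rfl⟩)
  · rw [id, ThetaEnvData.transport_mk]
    congr 1
    refine Subtype.ext (MulEquiv.ext fun x => ?_)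
    rw [ThetaEnvData.conjContAut_apply]
    change envShear M r (shift hδ ((envShear M r).symm x)) = shift hδ x
    rw [shift_apply, shift_apply, envShear_apply, envShear_symm_apply]
    exact SemidirectProduct.ext rfl (MulEquiv.apply_symm_apply _ _)
  · rw [id, ThetaEnvData.transport_mk]
    congr 1
    refine Subtype.ext (MulEquiv.ext fun x => ?_)
    rw [ThetaEnvData.conjContAut_apply]
    change envShear M r (((toy h1 hcof htot).level M).conjX g ((envShear M r).symm x)) =
      ((toy h1 hcof htot).level M).conjX g x
    refine SemidirectProduct.ext rfl (Subtype.ext ?_)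
    change shear r (g * shear (-r) (x.right : P) * g⁻¹) = g * (x.right : P) * g⁻¹
    rw [mul_inv_cancel_comm, mul_inv_cancel_comm, shear_shear, neg_add_cancel, shear_zero]

/-- **Shears divisible by the level are automorphisms of the model mono-theta environment**
`M_M = (Π^tp_Y[μ_M], D_Y, [Im s^Θ])` of the toy (Def 2.13 (ii)): they fix the cyclotome, stabilise
`D_Y` and `Im(s^Θ)`. [cite: MochizukiEtTh2009, Def 2.13(ii) p.48] -/
noncomputable def shearIso (M : E) (r : ℤ) (hr : (r : ZMod (M : ℕ+)) = 0) :
    (((toy h1 hcof htot).level M).modelMono (eta_mem h1 hcof htot M)).Iso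
      (((toy h1 hcof htot).level M).modelMono (eta_mem h1 hcof htot M)) where
  e := envShearC M r
  map_D := map_transport_envShearC_DY h1 hcof htot M r
  map_sTheta := by
    change (fun H => H.map (envShear M r).toMonoidHom) ''
        muConjClass augY0 (chi M) (((toy h1 hcof htot).level M).sTheta (eta_mem h1 hcof htot M)).range =
      muConjClass augY0 (chi M) (((toy h1 hcof htot).level M).sTheta (eta_mem h1 hcof htot M)).range
    rw [image_muConjClass_eq augY0 (chi M) (envShear M r) (fun a => SemidirectProduct.ext rfl
      (map_one (shearY r))), map_envShear_range_sTheta h1 hcof htot M hr]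

/-- The underlying automorphism of `shearIso`. [cite: MochizukiEtTh2009, Def 2.13(ii) p.48] -/
theorem shearIso_e (M : E) (r : ℤ) (hr : (r : ZMod (M : ℕ+)) = 0) :
    (shearIso h1 hcof htot M r hr).e = envShearC M r := rfl

/-! ## §7. Integer lifts of a compatible family of residues; the twisted system -/

section System

variable (x : ∀ M : E, ZMod (M : ℕ+))
  (hx : ∀ (M M' : E) (h : (M : ℕ+) ∣ M'), ZMod.castHom (PNat.dvd_iff.mp h) (ZMod (M : ℕ+)) (x M') = x M)

/-- Integer lifts `k_M ∈ [0, M)` of a family of residues `x_M ∈ ℤ/M`. [cite: MochizukiEtTh2009, Rmk 2.16.1(iii) p.56] -/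
def lift (M : E) : ℤ := ((x M).val : ℤ)

/-- `k_M ≡ x_M (mod M)`. [cite: MochizukiEtTh2009, Rmk 2.16.1(iii) p.56] -/
theorem cast_lift (M : E) : ((lift x M : ℤ) : ZMod (M : ℕ+)) = x M := by
  rw [lift, Int.cast_natCast, ZMod.natCast_zmod_val]

include hx in
/-- `k_{M'} ≡ x_M (mod M)` for `M ∣ M'` (compatibility). [cite: MochizukiEtTh2009, Rmk 2.16.1(iii) p.56] -/
theorem cast_lift_of_dvd (M M' : E) (h : (M : ℕ+) ∣ M') : ((lift x M' : ℤ) : ZMod (M : ℕ+)) = x M := by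
  rw [← hx M M' h, lift, Int.cast_natCast, ZMod.castHom_apply, ZMod.cast_eq_val]

include hx in
/-- `k_M - k_{M'} ≡ 0 (mod M)` for `M ∣ M'`. [cite: MochizukiEtTh2009, Rmk 2.16.1(iii) p.56] -/
theorem cast_lift_sub (M M' : E) (h : (M : ℕ+) ∣ M') :
    ((lift x M - lift x M' : ℤ) : ZMod (M : ℕ+)) = 0 := by
  rw [Int.cast_sub, cast_lift, cast_lift_of_dvd x hx M M' h, sub_self]

/-- **The twisted projective system of mono-theta environments** attached to a compatible family of
residues `x = (x_M)_M`: objects the models `M_M = modelMono η_M`, transition maps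
`γ_{M',M} = a_{M',M} ∘ red` with the twist `a_{M',M} :=` the shear of `Π^tp_Y[μ_M]` by `k_M - k_{M'}`
(`k` = integer lifts of `x`; `M ∣ k_M - k_{M'}`, so `a_{M',M} ∈ Aut(M_M)`); `γ_{M,M} = id` and the
`γ` compose. [cite: MochizukiEtTh2009, Cor 2.19(ii) p.64] -/
noncomputable def system : (toy h1 hcof htot).MTESystem where
  η M := eta M
  mem M := eta_mem h1 hcof htot M
  compat M M' h := funext fun g => redMu_eta _ _ _ g
  a M M' _ := (envShearC M (lift x M - lift x M')).toMulEquiv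
  isAut M M' h := ⟨shearIso h1 hcof htot M _ (cast_lift_sub x hx M M' h), rfl⟩
  a_self M h := by
    refine MulEquiv.ext fun y => SemidirectProduct.ext rfl (Subtype.ext ?_)
    change shear (lift x M - lift x M) (y.right : P) = y.right
    rw [sub_self, shear_zero]
  a_comp M M' M'' h h' y := by
    refine SemidirectProduct.ext ?_ (Subtype.ext ?_)
    · change redMu M M'' (PNat.dvd_iff.1 (h.trans h')) y.left =
        redMu M M' (PNat.dvd_iff.1 h) (redMu M' M'' (PNat.dvd_iff.1 h') y.left)
      exact redMu_comp _ _ _ _ _ _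
    · change shear (lift x M - lift x M'') (y.right : P) =
        shear (lift x M - lift x M') (shear (lift x M' - lift x M'') (y.right : P))
      rw [shear_shear, show lift x M' - lift x M'' + (lift x M - lift x M') = lift x M - lift x M'' by ring]

/-- The twist of the system in coordinates. [cite: MochizukiEtTh2009, Cor 2.19(ii) p.64] -/
theorem system_a_apply (M M' : E) (h : (M : ℕ+) ∣ M') (y : Env M) :
    (system h1 hcof htot x hx).a M M' h y = ⟨y.left, shearY (lift x M - lift x M') y.right⟩ := rfl

end System

end InvToy

end ThetaEnvTower

end Literature.AnabelianGeometry.EtaleTheta
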